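import Literature.AlgebraicGeometry.HodgeTheory.WeilClassesFieldDefiniteQuaternionDichotomy
import Literature.AlgebraicGeometry.HodgeTheory.WeilClassesFieldCMCentreDichotomy
import Mathlib.FieldTheory.Minpoly.Field
import HarnessLib

/-!
# Moonen–Zarhin's Criterion (2), TYPE 4 WITH `d = 1` («`End⁰(Y) = E` a CM field») ON `A` AND ON THE POWERS `A^{n+1}`,
# FROM `End(A)`-LEVEL DATA: `W_F` decomposable ⟺ the multiplicities of `σ` for `ψ` and `ψ†` on every `V_ρ` balance
# («`θ = 0`»), all non-zero classes exceptional ⟺ some imbalance («`θ ≠ 0`», resp. «`F ⊄ E₀`» for `m = 1`), with the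
# centrality of `ψ`, «`ψ† ∈ E`», «`F ⊆ M_{n+1}(E)`» and «no real place» DISCHARGED from «`End⁰(A) = ℚ(ψ)`, `ψ† ≠ ψ`»
# (Moonen–Zarhin 1998 §1, Criterion (2); Milne 1999 §1)

Layer `Literature/AlgebraicGeometry/HodgeTheory`; THEOREMS ONLY — no definition, no named fact, no `sorry` (D-0026, net
debt 0).  End-level wrapper of the seat's generation-22 files `WeilClassesFieldCMCentreMatricesDecomposable` (the
mechanism «balance ⟹ decomposable», torus normalisation on the Morita corners), `WeilClassesFieldExceptionalOfCentralTorus`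
(«imbalance ⟹ exceptional», the torus `U_E(ℂ) ⊂ S(A)(h)(ℂ)`) and `WeilClassesFieldCMCentreDichotomy` (the two `iff`s),
in the format of `WeilClassesFieldDefiniteQuaternionMatricesEndLevel` (type 3) and `WeilClassesFieldDefiniteQuaternionDichotomy`
(type 3, `m = 1`): the hypotheses «`ψ` central», «`ψ^* ∈ C(A) ⊗ ℂ`», «`ψ'^* ∈ ℂ[ψ^*]`», «`F ⊆ E`» / «`F ⊆ M_{n+1}(E)`»
(`φ^* ∈ ℂ[ψ^*]`, resp. entries of `φ` polynomial in `ψ`) and «no real place» (`ker(ψ^* - σ) ∩ ker(ψ'^* - σ) = 0`) of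
those files are ALL DERIVED from the two End-level data «`End⁰(A) = E = ℚ(ψ)`» (every `g ∈ End(A)` has a non-zero
integer multiple in `ℤ[ψ]`) and «`ψ† ≠ ψ`» (`ψ' ≠ ψ` for the Rosati image `ψ'`).

## The print

B. J. J. Moonen, Yu. G. Zarhin, *Weil classes on abelian varieties*, J. reine angew. Math. **496** (1998) 83–92 =
arXiv:alg-geom/9612017 [MoonenZarhin1998WeilClasses] (held text `paper:arxiv-alg-geom_9612017`), §1, VERBATIM: «Let
`D = End⁰(Y)`, let `E` be the center of `D`, and let `E₀` be the maximal totally real subfield of `E`.  We write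
`e₀ = [E₀:ℚ]`, `e = [E:ℚ]`, `d² = dim_E(D)` …» (chunk p0002 L46–L51); Criterion (2) (chunk p0003 L59–L80): «… this last
possibility occurs precisely in the following cases: … `Y` is of Type 4, `d = 1`, `m = 1` and `F ⊄ E₀`, `Y` is of Type
4 with `d ≥ 2` or `m ≥ 2` and the map `θ : E₋ ↪ End_F(V_X) → F` (`Tr_F`) is non-zero.»; its proof (chunk p0003
L92–L106): «Next assume that `X` is of type 4 with either `m ≥ 2` or `d ≥ 2`.  We have `F ⊆ B = End⁰(X)`.  Since in this
case `G_div(X)` is connected …, it acts trivially on `W_F` if and only if the composition `U_E = Z(G_div) ⊂ G_div(X) ↪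
Gl_F(V_Y) → F^*` (`det_F`) is trivial.  The torus `U_E` being connected, this is the case if and only if the induced map
on Lie algebras `θ : E₋ ↪ End_F(V_X) → F` is zero.»
J. S. Milne, *Lefschetz classes on abelian varieties* [Milne1999LefschetzClasses], §1 (the centraliser `C(A)`, the group
`S(A)`), Thm. 3.2, Cor. 4.5.  H. Lange, Ch. Birkenhake [LangeBirkenhake1992], §1.1 (faithfulness of the rational
representation), §5.5 (type IV: `End⁰` central simple over a CM field, Rosati = complex conjugation on the centre).

## The carrier and the data

`V = H¹(A(ℂ); ℂ)`, `χ^* = pullbackOne A χ`, `Q_h` for `h ∈ B¹(A) ⊗ ℂ` (`h^{dim A} ≠ 0` for the powers) with `Q_h`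
non-degenerate; `X = A^{n+1} = ⨁_{Fin (n+1)} A` with the product polarization; `W_F ⊗ ℂ = weilClassesField X φ P (2m)`
for `P(φ) = 0`, `P ∈ ℤ[T]` monic irreducible of degree `e`, `e · 2m = 2 dim X`; `𝒟ᵐ ⊗ ℂ = divisorClassesSpan`;
`V_ρ = ker(φ^* - ρ)`.  THE TYPE-4, `d = 1` DATA IN `End(A)`: `ψ ∈ End(A)` with `R(ψ) = 0` (`R ∈ ℤ[T]` monic irreducible
over `ℚ`, `E = ℚ(ψ)`); its Rosati image `ψ' ∈ End(A)`, `Q_h(ψ^* x, y) = Q_h(x, ψ'^* y)` (on the carrier — the Rosati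
involution itself is not formalised at End level in this layer) with `ψ' ≠ ψ` («`E` is a CM field, `†` its complex
conjugation», as opposed to type 1); and «`End⁰(A) = E`»: `hD : ∀ g, ∃ N ≠ 0, N g ∈ ℤ[ψ]`.  The multiplicities:
`n_{ρ,σ} = dim(V_ρ ∩ ker((⊕ψ)^* - σ))`, `n′_{ρ,σ} = dim(V_ρ ∩ ker((⊕ψ')^* - σ)) = n_{ρ,σ̄}`; «`θ = 0`» is the BALANCE
`n_{ρ,σ} = n′_{ρ,σ}` for all `ρ, σ` (the seat's reading of `θ(e₋) = Tr_F(e₋ | V_X)`, place by place, as in the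
generation-22 files); for `m = 1` and `F ⊆ E` it reads «`σ|_F = σ̄|_F` for every embedding `σ` of `E`», i.e. «`F ⊆ E₀`».

## What is proved

* §1 «`End⁰(A) = ℚ(ψ)`» ON `H¹` (`hD` only): `pullbackOne_mem_adjoin_singleton_of_forall_exists_zsmul_mem_closure_singleton`
  (EVERY `g^*` lies in `ℂ[ψ^*] = E ⊗ ℂ`), `pullbackOne_mul_comm_of_forall_exists_zsmul_mem_closure_singleton` and
  **`comp_comm_of_forall_exists_zsmul_mem_closure_singleton`** (`End(A)` IS COMMUTATIVE — faithfulness of `H¹`),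
  `pullbackOne_mem_centralizerAlgebra_of_forall_exists_zsmul_mem_closure_singleton` (`g^* ∈ C(A) ⊗ ℂ`),
  `pullbackOne_biproduct_mem_adjoin_diagonal_of_forall_exists_zsmul_mem_closure_singleton` («`End⁰(A^{n+1}) =
  M_{n+1}(E)`»: every pull-back on `H¹(A^{n+1})` lies in `ℂ⟨(⊕ψ)^*, (πₐ ≫ ι_b)^*⟩`), and
  **`eigenspace_inf_eigenspace_eq_bot_of_ne_of_forall_exists_zsmul_mem_closure_singleton`** («NO REAL PLACE» from
  `ψ' ≠ ψ`: if `ker(ψ^* - σ) ∩ ker(ψ'^* - σ) ≠ 0` then `c(σ) = N'σ` for the integer polynomial with `N'ψ' = c(ψ)`, so the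
  minimal polynomial `R` of `σ` divides `c - N'X`, `N'ψ'^* = c(ψ^*) = N'ψ^*`, and `ψ' = ψ` by faithfulness).
* §2 `m = 1` (`F ⊆ E = End⁰(A)`, any `φ ∈ End(A)`):
  **`weilClassesField_le_divisorClassesSpan_iff_forall_finrank_eq_of_CMField_End`** (`W_F ⊗ ℂ ≤ 𝒟ᵐ ⊗ ℂ ↔` balance),
  **`weilClassesField_inf_divisorClassesSpan_eq_bot_iff_exists_finrank_ne_of_CMField_End`** (`= ⊥ ↔` some imbalance —
  the print's «`m = 1` and `F ⊄ E₀`» in multiplicity form), the dichotomy `…_le_or_inf_…`.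
* §3 POWERS `X = A^{n+1}` (`F ⊆ End⁰(X) = M_{n+1}(E)`, any `φ ∈ End(X)`):
  `weilClassesField_biproduct_le_divisorClassesSpan_of_mem_adjoin_diagonal_of_forall_finrank_eq` (the generation-22
  decomposable half with «entries of `φ` polynomial in `ψ`» relaxed to `φ^* ∈ ℂ⟨(⊕ψ)^*, (πₐ ≫ ι_b)^*⟩` on the carrier),
  **`weilClassesField_biproduct_le_divisorClassesSpan_iff_forall_finrank_eq_of_CMField_End`** («`θ = 0` ⟺ decomposable»),
  **`weilClassesField_biproduct_inf_divisorClassesSpan_eq_bot_iff_exists_finrank_ne_of_CMField_End`** («`θ ≠ 0` ⟺ all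
  non-zero classes exceptional»), the dichotomy.

## Scope (honest column)

As in the generation-22 files and the type-3 End-level files: no Albert classification, simplicity or `X ∼ Y^m`; the
type-4, `d = 1` structure is the PRESENTATION «`End⁰(A) = ℚ(ψ)`, `ψ' = ψ† ≠ ψ`» (`hD`, `hadj`, `hne`); that a simple
complex abelian variety of type IV with `d = 1` admits it is Albert's classification, NOT proved here; that `E` is then
a CM field with `†` = complex conjugation is USED only through its consequence «no real place» (§1, proved).  «`θ = 0`»
is formalised as the balance of multiplicities (place by place), not as the vanishing of a trace map `E₋ → F`; the
print's «`F ⊄ E₀`» (`m = 1`) is not restated field-theoretically.  Everything is on `ℂ`-points of Milne's `S(A)(h)`.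

## References

* [MoonenZarhin1998WeilClasses] B. J. J. Moonen, Yu. G. Zarhin, Weil classes on abelian varieties, J. reine angew.
  Math. 496 (1998) 83–92; arXiv:alg-geom/9612017: §1 (chunk p0002 L43–L118; Lemma (1)–(3) chunk p0003 L1–L12),
  Criterion (2) and its proof (chunk p0003 L59–L106), Remark (2) (chunk p0004 L48–L53).
* [Milne1999LefschetzClasses] J. S. Milne, Lefschetz classes on abelian varieties, Duke Math. J. 96 (1999), §1
  pp. 642–644, Thm. 3.2, Cor. 4.5.
* [LangeBirkenhake1992] H. Lange, Ch. Birkenhake, Complex Abelian Varieties, Grundlehren 302 (1992), §1.1, §5.5.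
* [McconnellRobson2001] J. C. McConnell, J. C. Robson, Noncommutative Noetherian Rings, GSM 30 (AMS 2001),
  3.5.5–3.5.7 (matrix units).

## Provenance

Lane `lit-hodgefound` (Track 2, Layer A), prover seat `lit-hodgefound-p21` (generation 24), row g24-#2 (successor note
(c) of generation 23, its End-level part for `d = 1`).
-/

noncomputable section

open CategoryTheory CategoryTheory.Limits
open Polynomial Module

namespace Literature.AlgebraicGeometry.HodgeTheory

open Literature.AlgebraicTopology.SingularHomology
open Literature.AlgebraicGeometry.Motives
open Literature.AlgebraicGeometry.VanGeemen1994 (hodgeClassSpan pullbackOne)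
open Literature.AlgebraicGeometry.Milne1999
open Literature.Geometry.Kaehler (lefschetzPow)
open Literature.Barriers.HodgeConjecture (divisorClassesSpan)
open Literature.LinearAlgebra

/-! ### §1 «`End⁰(A) = E = ℚ(ψ)`» read on `H¹(A(ℂ); ℂ)`: every pull-back is a polynomial in `ψ^*`, `End(A)` is
commutative, `End⁰(A^{n+1}) = M_{n+1}(E)`, and «no real place» from `ψ† ≠ ψ` -/

section CMField

variable {A : AbelianVariety ℂ} {h : complexBetti A.X 2} {ψ ψ' φ : A ⟶ A} {R : Polynomial ℤ} {n : ℕ}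

/-- **«`End⁰(A) = ℚ(ψ)`» ⟹ every `g^*` lies in `E ⊗ ℂ = ℂ[ψ^*]`**: if `N g ∈ ℤ[ψ]` with `N ≠ 0` then `g^* = N⁻¹ (N g)^*`
is a complex polynomial in `ψ^*`. [cite: MoonenZarhin1998WeilClasses, §1 («D = End⁰(Y)», «E the center of D», d = 1: D = E; chunk p0002 L46–L51)]
[cite: LangeBirkenhake1992, §1.1] -/
theorem pullbackOne_mem_adjoin_singleton_of_forall_exists_zsmul_mem_closure_singleton
    (hD : ∀ g : A ⟶ A, ∃ N : ℤ, N ≠ 0 ∧ End.of (N • g) ∈ Subring.closure {End.of ψ}) (g : A ⟶ A) :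
    pullbackOne A g ∈ Algebra.adjoin ℂ ({pullbackOne A ψ} : Set (Module.End ℂ (complexBetti A.X 1))) := by
  obtain ⟨N, hN0, hN⟩ := hD g
  have h1 : pullbackOne A (N • g) ∈ Algebra.adjoin ℂ ({pullbackOne A ψ} : Set (Module.End ℂ (complexBetti A.X 1))) :=
    pullbackOne_mem_adjoin_singleton_of_mem_closure hN
  rw [pullbackOne_zsmul] at h1
  have e : pullbackOne A g = ((N : ℂ)⁻¹) • ((N : ℂ) • pullbackOne A g) := by
    rw [smul_smul, inv_mul_cancel₀ (Int.cast_ne_zero.2 hN0), one_smul]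
  rw [e]
  exact Subalgebra.smul_mem _ h1 _

/-- **… so any two pull-backs commute** (`ℂ[ψ^*]` is commutative). [cite: MoonenZarhin1998WeilClasses, §1 (d = 1: D = E commutative; chunk p0002 L46–L51)]
[cite: LangeBirkenhake1992, §1.1] -/
theorem pullbackOne_mul_comm_of_forall_exists_zsmul_mem_closure_singleton
    (hD : ∀ g : A ⟶ A, ∃ N : ℤ, N ≠ 0 ∧ End.of (N • g) ∈ Subring.closure {End.of ψ}) (g g' : A ⟶ A) :
    pullbackOne A g * pullbackOne A g' = pullbackOne A g' * pullbackOne A g := by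
  have hg := pullbackOne_mem_adjoin_singleton_of_forall_exists_zsmul_mem_closure_singleton hD g
  have hg' := pullbackOne_mem_adjoin_singleton_of_forall_exists_zsmul_mem_closure_singleton hD g'
  rw [Algebra.adjoin_singleton_eq_range_aeval] at hg hg'
  obtain ⟨p, hp⟩ := hg
  obtain ⟨q, hq⟩ := hg'
  rw [← hp, ← hq]
  change aeval (pullbackOne A ψ) p * aeval (pullbackOne A ψ) q = aeval (pullbackOne A ψ) q * aeval (pullbackOne A ψ) p
  rw [← map_mul, ← map_mul, mul_comm]

/-- **«`End⁰(A) = ℚ(ψ)`» ⟹ `End(A)` IS COMMUTATIVE**: `g ≫ g' = g' ≫ g` for all `g, g' ∈ End(A)` — the pull-backs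
commute and the representation of `End(A)` on `H¹(A(ℂ); ℂ)` is faithful.  In particular `ψ` is central (the hypothesis
«`ψ` central» of the generation-22 files). [cite: MoonenZarhin1998WeilClasses, §1 (d = 1: D = E; chunk p0002 L46–L51)]
[cite: LangeBirkenhake1992, §1.1 (faithfulness of the rational representation)] -/
theorem comp_comm_of_forall_exists_zsmul_mem_closure_singleton
    (hD : ∀ g : A ⟶ A, ∃ N : ℤ, N ≠ 0 ∧ End.of (N • g) ∈ Subring.closure {End.of ψ}) (g g' : A ⟶ A) :
    g ≫ g' = g' ≫ g := by
  have e1 : pullbackOne A (g ≫ g') = pullbackOne A (g' ≫ g) := by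
    rw [pullbackOne_comp_eq_mul, pullbackOne_comp_eq_mul,
      pullbackOne_mul_comm_of_forall_exists_zsmul_mem_closure_singleton hD g g']
  have e0 : (complexBetti.map (g ≫ g' - g' ≫ g).hom.hom.hom 1).hom = 0 := by
    rw [complexBetti_map_sub_one, ModuleCat.hom_sub]
    exact sub_eq_zero.2 e1
  exact sub_eq_zero.1 (ComplexMultiplication.hom_eq_zero_of_complexBetti_map_one_eq_zero _ e0)

/-- **… so every `g^*` lies in Milne's `C(A) ⊗ ℂ`** (the hypothesis `ψ^* ∈ centralizerAlgebra A` of the generation-22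
files). [cite: Milne1999LefschetzClasses, §1 p. 642 (C(A))] [cite: MoonenZarhin1998WeilClasses, §1 (chunk p0002 L46–L51)] -/
theorem pullbackOne_mem_centralizerAlgebra_of_forall_exists_zsmul_mem_closure_singleton
    (hD : ∀ g : A ⟶ A, ∃ N : ℤ, N ≠ 0 ∧ End.of (N • g) ∈ Subring.closure {End.of ψ}) (g : A ⟶ A) :
    pullbackOne A g ∈ centralizerAlgebra A :=
  mem_centralizerAlgebra_iff.2 fun χ ↦ pullbackOne_mul_comm_of_forall_exists_zsmul_mem_closure_singleton hD χ g

/-- **«`End⁰(A^{n+1}) = M_{n+1}(E)`» ON THE CARRIER**: under «`End⁰(A) = ℚ(ψ)`», every pull-back `χ^*`,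
`χ ∈ End(A^{n+1})`, lies in `ℂ⟨(⊕ψ)^*, (πₐ ≫ ι_b)^*⟩` (clear the denominators of the `(n+1)²` entries; the seat's
`pullbackOne_mem_adjoin_diagonal_of_forall_exists_zsmul_mem_closure_triple` with `α = β = ψ`).
[cite: MoonenZarhin1998WeilClasses, §1 Table 1 / proof of Criterion (2) («F ⊆ B = End⁰(X)», «End⁰(X) = M_m(D)»; chunk p0002 L54–L90, chunk p0003 L92–L94)]
[cite: McconnellRobson2001, 3.5.5–3.5.7] -/
theorem pullbackOne_biproduct_mem_adjoin_diagonal_of_forall_exists_zsmul_mem_closure_singleton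
    (hD : ∀ g : A ⟶ A, ∃ N : ℤ, N ≠ 0 ∧ End.of (N • g) ∈ Subring.closure {End.of ψ})
    (χ : (⨁ (fun _ : Fin (n + 1) => A)) ⟶ (⨁ (fun _ : Fin (n + 1) => A))) :
    pullbackOne (⨁ (fun _ : Fin (n + 1) => A)) χ ∈ Algebra.adjoin ℂ
      (insert (pullbackOne (⨁ (fun _ : Fin (n + 1) => A)) (biproduct.map fun _ : Fin (n + 1) => ψ))
        (Set.range fun ab : Fin (n + 1) × Fin (n + 1) ↦ pullbackOne (⨁ (fun _ : Fin (n + 1) => A))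
          (biproduct.π (fun _ : Fin (n + 1) => A) ab.1 ≫ biproduct.ι (fun _ : Fin (n + 1) => A) ab.2))) := by
  have e : ({End.of ψ, End.of ψ, End.of ψ} : Set (CategoryTheory.End A)) = {End.of ψ} := by
    rw [Set.insert_eq_of_mem (Set.mem_insert _ _), Set.insert_eq_of_mem (Set.mem_singleton _)]
  have hD3 : ∀ g : A ⟶ A, ∃ N : ℤ, N ≠ 0 ∧ End.of (N • g) ∈ Subring.closure {End.of ψ, End.of ψ, End.of ψ} :=
    fun g ↦ by rw [e]; exact hD g
  have h1 := pullbackOne_mem_adjoin_diagonal_of_forall_exists_zsmul_mem_closure_triple (n := n) hD3 χ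
  rwa [Set.insert_eq_of_mem (Set.mem_insert _ _), Set.insert_eq_of_mem (Set.mem_insert _ _)] at h1

/-- **«NO REAL PLACE» FROM `ψ† ≠ ψ`.**  Under «`End⁰(A) = ℚ(ψ)`» (`R(ψ) = 0`, `R` monic irreducible over `ℚ`), let
`ψ' ∈ End(A)` with `ψ' ≠ ψ`.  Then `ker(ψ^* - σ) ∩ ker(ψ'^* - σ) = 0` for every `σ ∈ ℂ`: writing `N'ψ' = c(ψ)`
(`c ∈ ℤ[X]`), a non-zero common eigenvector gives `c(σ) = N'σ` at a complex root `σ` of `R`, so the minimal polynomial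
`R` of `σ` over `ℚ` divides `c - N'X`, whence `N'ψ'^* = c(ψ^*) = N'ψ^*` and `ψ' = ψ` by faithfulness.  For the Rosati
image `ψ' = ψ†` this is «`E = ℚ(ψ)` is a CM field and `†` its complex conjugation: `σ̄ ≠ σ` at every place» (type 4
rather than type 1). [cite: MoonenZarhin1998WeilClasses, §1 («E₀ the maximal totally real subfield of E», the torus U_E; chunk p0002 L46–L51, chunk p0003 L1–L3, L92–L106)]
[cite: LangeBirkenhake1992, §1.1, §5.5] -/
theorem eigenspace_inf_eigenspace_eq_bot_of_ne_of_forall_exists_zsmul_mem_closure_singleton (hRm : R.Monic)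
    (hRirr : Irreducible (R.map (Int.castRingHom ℚ)))
    (hψR : Polynomial.eval₂ (Int.castRingHom (CategoryTheory.End A)) (ψ : CategoryTheory.End A) R = 0)
    (hD : ∀ g : A ⟶ A, ∃ N : ℤ, N ≠ 0 ∧ End.of (N • g) ∈ Subring.closure {End.of ψ}) (hne : ψ' ≠ ψ) (σ : ℂ) :
    (pullbackOne A ψ).eigenspace σ ⊓ (pullbackOne A ψ').eigenspace σ = ⊥ := by
  by_contra hbot
  obtain ⟨x, ⟨hxψ, hxψ'⟩, hx0⟩ := (Submodule.ne_bot_iff _).1 hbot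
  -- `N' ψ' = c(ψ)` with `c ∈ ℤ[X]`
  obtain ⟨N', hN'0, hN'⟩ := hD ψ'
  have hcomm : ∀ k : ℤ, Commute (Int.castRingHom (CategoryTheory.End A) k) (End.of ψ) := fun k ↦
    Int.cast_commute k _
  have hrange : Subring.closure {End.of ψ} ≤
      (Polynomial.eval₂RingHom' (Int.castRingHom (CategoryTheory.End A)) (End.of ψ) hcomm).range :=
    Subring.closure_le.2 (Set.singleton_subset_iff.2 ⟨X, by
      change Polynomial.eval₂ (Int.castRingHom (CategoryTheory.End A)) (End.of ψ) X = End.of ψ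
      exact eval₂_X _ _⟩)
  obtain ⟨c, hc⟩ := hrange hN'
  have hc' : (N' • ψ' : A ⟶ A) =
      (Polynomial.eval₂ (Int.castRingHom (CategoryTheory.End A)) (ψ : CategoryTheory.End A) c :) :=
    hc.symm
  have h2 : (N' : ℂ) • pullbackOne A ψ' = aeval (pullbackOne A ψ) (c.map (Int.castRingHom ℂ)) := by
    rw [← pullbackOne_zsmul, hc']
    exact pullbackOne_eval₂ ψ c
  -- at the common eigenvector: `c(σ) = N' σ`
  have hσR : Polynomial.eval₂ (Int.castRingHom ℂ) σ R = 0 :=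
    eval₂_eq_zero_of_eigenspace_pullbackOne_ne_bot hψR ((Submodule.ne_bot_iff _).2 ⟨x, hxψ, hx0⟩)
  have hcσ : (c.map (Int.castRingHom ℂ)).eval σ = (N' : ℂ) * σ := by
    have e1 : aeval (pullbackOne A ψ) (c.map (Int.castRingHom ℂ)) x = (c.map (Int.castRingHom ℂ)).eval σ • x :=
      Module.End.aeval_apply_of_hasEigenvector (Module.End.hasEigenvector_iff.2 ⟨hxψ, hx0⟩)
    have e2 : aeval (pullbackOne A ψ) (c.map (Int.castRingHom ℂ)) x = ((N' : ℂ) * σ) • x := by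
      rw [← h2, LinearMap.smul_apply, Module.End.mem_eigenspace_iff.1 hxψ', smul_smul]
    rw [e1] at e2
    exact smul_left_injective ℂ hx0 e2
  -- the minimal polynomial of `σ` over `ℚ` is `R`; it divides `c - N' X`
  set q : Polynomial ℤ := c - C N' * X with hqdef
  have hqσ : Polynomial.aeval σ (q.map (Int.castRingHom ℚ)) = 0 := by
    rw [aeval_def, eval₂_map, RingHom.ext_int ((algebraMap ℚ ℂ).comp (Int.castRingHom ℚ)) (Int.castRingHom ℂ), hqdef,
      eval₂_sub, eval₂_mul, eval₂_C, eval₂_X, ← Polynomial.eval_map, hcσ, eq_intCast, sub_self]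
  have hRσ : Polynomial.aeval σ (R.map (Int.castRingHom ℚ)) = 0 := by
    rw [aeval_def, eval₂_map, RingHom.ext_int ((algebraMap ℚ ℂ).comp (Int.castRingHom ℚ)) (Int.castRingHom ℂ)]
    exact hσR
  have hmin : R.map (Int.castRingHom ℚ) = minpoly ℚ σ :=
    minpoly.eq_of_irreducible_of_monic hRirr hRσ (hRm.map _)
  have hdvd : R.map (Int.castRingHom ℚ) ∣ q.map (Int.castRingHom ℚ) := by
    rw [hmin]
    exact minpoly.dvd ℚ σ hqσ
  have hdvdC : R.map (Int.castRingHom ℂ) ∣ q.map (Int.castRingHom ℂ) := by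
    have h := Polynomial.map_dvd (algebraMap ℚ ℂ) hdvd
    rwa [Polynomial.map_map, Polynomial.map_map,
      RingHom.ext_int ((algebraMap ℚ ℂ).comp (Int.castRingHom ℚ)) (Int.castRingHom ℂ)] at h
  -- hence `q(ψ^*) = 0`, i.e. `N' ψ'^* = N' ψ^*`
  have hR0 : aeval (pullbackOne A ψ) (R.map (Int.castRingHom ℂ)) = 0 := by
    have h1 := pullbackOne_eval₂ ψ R
    rw [hψR] at h1
    have h0 : pullbackOne A ((0 : CategoryTheory.End A) :) = 0 := pullbackOne_zero_eq_zero
    rw [h0] at h1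
    exact h1.symm
  have hq0 : aeval (pullbackOne A ψ) (q.map (Int.castRingHom ℂ)) = 0 := by
    obtain ⟨s, hs⟩ := hdvdC
    rw [hs, map_mul, hR0, zero_mul]
  have h3 : (N' : ℂ) • pullbackOne A ψ' = (N' : ℂ) • pullbackOne A ψ := by
    rw [hqdef, Polynomial.map_sub, Polynomial.map_mul, Polynomial.map_C, Polynomial.map_X, map_sub, map_mul, aeval_C,
      aeval_X, ← h2, eq_intCast, sub_eq_zero, Algebra.algebraMap_eq_smul_one, smul_mul_assoc, one_mul] at hq0
    exact hq0
  have h4 : pullbackOne A ψ' = pullbackOne A ψ := smul_right_injective _ (Int.cast_ne_zero.2 hN'0) h3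
  -- faithfulness
  have e0 : (complexBetti.map (ψ' - ψ).hom.hom.hom 1).hom = 0 := by
    rw [complexBetti_map_sub_one, ModuleCat.hom_sub]
    exact sub_eq_zero.2 h4
  exact hne (sub_eq_zero.1 (ComplexMultiplication.hom_eq_zero_of_complexBetti_map_one_eq_zero _ e0))

end CMField

/-! ### §2 `m = 1`: `F ⊆ E = End⁰(A)` — the dichotomy from `End(A)`-level data -/

section Simple

variable {A : AbelianVariety ℂ} {h : complexBetti A.X 2} {ψ ψ' φ : A ⟶ A} {P R : Polynomial ℤ} {e m : ℕ}

/-- **TYPE 4 WITH `d = 1`, `m = 1`, FROM `End(A)` — DECOMPOSABLE IFF BALANCED.**  Let `A` be a complex abelian variety,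
`h ∈ B¹(A) ⊗ ℂ` with `Q_h` non-degenerate, `ψ ∈ End(A)` with `R(ψ) = 0` (`R` monic irreducible over `ℚ`), «`End⁰(A) =
ℚ(ψ)`» (every `g ∈ End(A)` has a non-zero multiple in `ℤ[ψ]`), and `ψ' ∈ End(A)` the Rosati image of `ψ`
(`Q_h(ψ^* x, y) = Q_h(x, ψ'^* y)`) with `ψ' ≠ ψ`.  Then for every `φ ∈ End(A)` with `P(φ) = 0` (`P` monic irreducible of
degree `e`, `e · 2m = 2 dim A`, `m ≠ 0`): `W_F ⊗ ℂ ≤ 𝒟ᵐ ⊗ ℂ` IFF `dim(V_ρ ∩ ker(ψ^* - σ)) = dim(V_ρ ∩ ker(ψ'^* - σ))`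
for every complex root `ρ` of `P` and every `σ` — the generation-22 carrier criterion
`weilClassesField_le_divisorClassesSpan_iff_forall_finrank_eq_of_central` with `ψ^* ∈ C(A) ⊗ ℂ`, `ψ'^* ∈ ℂ[ψ^*]`,
«no real place» and `φ^* ∈ ℂ[ψ^*]` discharged by §1.  The print: type 4, `d = 1`, `m = 1`: exceptional iff «`F ⊄ E₀`».
[cite: MoonenZarhin1998WeilClasses, §1 Criterion (2), cases «Y is of Type 4, d = 1, m = 1 and F ⊄ E₀» / «θ non-zero» and its proof (chunk p0003 L59–L106)]
[cite: Milne1999LefschetzClasses, §1 pp. 642–644, Thm. 3.2, Cor. 4.5] -/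
theorem weilClassesField_le_divisorClassesSpan_iff_forall_finrank_eq_of_CMField_End (hPm : P.Monic)
    (hPe : P.natDegree = e) (hPirr : Irreducible (P.map (Int.castRingHom ℚ)))
    (hφ : Polynomial.eval₂ (Int.castRingHom (CategoryTheory.End A)) (φ : CategoryTheory.End A) P = 0)
    (her : e * (2 * m) = 2 * A.dim) (hm : m ≠ 0) (hh : h ∈ hodgeClassSpan A.dim A.X 1)
    (hnd : ∀ x : complexBetti A.X 1, (∀ y, polarizationPairingOne A.X h (A.dim - 1) x y = 0) → x = 0)
    (hRm : R.Monic) (hRirr : Irreducible (R.map (Int.castRingHom ℚ)))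
    (hψR : Polynomial.eval₂ (Int.castRingHom (CategoryTheory.End A)) (ψ : CategoryTheory.End A) R = 0)
    (hadj : ∀ x y : complexBetti A.X 1, polarizationPairingOne A.X h (A.dim - 1) (pullbackOne A ψ x) y =
      polarizationPairingOne A.X h (A.dim - 1) x (pullbackOne A ψ' y))
    (hne : ψ' ≠ ψ)
    (hD : ∀ g : A ⟶ A, ∃ N : ℤ, N ≠ 0 ∧ End.of (N • g) ∈ Subring.closure {End.of ψ}) :
    weilClassesField A φ P (2 * m) ≤ divisorClassesSpan A.X A.dim m ↔
      ∀ ρ : ℂ, Polynomial.eval₂ (Int.castRingHom ℂ) ρ P = 0 → ∀ σ : ℂ,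
        Module.finrank ℂ ↥((pullbackOne A φ).eigenspace ρ ⊓ (pullbackOne A ψ).eigenspace σ) =
          Module.finrank ℂ ↥((pullbackOne A φ).eigenspace ρ ⊓ (pullbackOne A ψ').eigenspace σ) :=
  weilClassesField_le_divisorClassesSpan_iff_forall_finrank_eq_of_central hPm hPe hPirr hφ her hm hh hnd
    (pullbackOne_mem_centralizerAlgebra_of_forall_exists_zsmul_mem_closure_singleton hD ψ) hRm hRirr hψR
    (pullbackOne_mem_adjoin_singleton_of_forall_exists_zsmul_mem_closure_singleton hD ψ') hadj
    (eigenspace_inf_eigenspace_eq_bot_of_ne_of_forall_exists_zsmul_mem_closure_singleton hRm hRirr hψR hD hne)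
    (pullbackOne_mem_adjoin_singleton_of_forall_exists_zsmul_mem_closure_singleton hD φ)

/-- **TYPE 4 WITH `d = 1`, `m = 1`, FROM `End(A)` — ALL NON-ZERO CLASSES EXCEPTIONAL IFF SOME IMBALANCE**
(`W_F ⊗ ℂ ⊓ 𝒟ᵐ ⊗ ℂ = ⊥ ↔ ∃ ρ σ, P(ρ) = 0 ∧ dim(V_ρ ∩ ker(ψ^* - σ)) ≠ dim(V_ρ ∩ ker(ψ'^* - σ))`), same hypotheses.
[cite: MoonenZarhin1998WeilClasses, §1 Criterion (2), cases «Y is of Type 4, d = 1, m = 1 and F ⊄ E₀» / «θ non-zero» and its proof (chunk p0003 L59–L106)]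
[cite: Milne1999LefschetzClasses, §1 pp. 642–644, Thm. 3.2, Cor. 4.5] -/
theorem weilClassesField_inf_divisorClassesSpan_eq_bot_iff_exists_finrank_ne_of_CMField_End (hPm : P.Monic)
    (hPe : P.natDegree = e) (hPirr : Irreducible (P.map (Int.castRingHom ℚ)))
    (hφ : Polynomial.eval₂ (Int.castRingHom (CategoryTheory.End A)) (φ : CategoryTheory.End A) P = 0)
    (her : e * (2 * m) = 2 * A.dim) (hm : m ≠ 0) (hh : h ∈ hodgeClassSpan A.dim A.X 1)
    (hnd : ∀ x : complexBetti A.X 1, (∀ y, polarizationPairingOne A.X h (A.dim - 1) x y = 0) → x = 0)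
    (hRm : R.Monic) (hRirr : Irreducible (R.map (Int.castRingHom ℚ)))
    (hψR : Polynomial.eval₂ (Int.castRingHom (CategoryTheory.End A)) (ψ : CategoryTheory.End A) R = 0)
    (hadj : ∀ x y : complexBetti A.X 1, polarizationPairingOne A.X h (A.dim - 1) (pullbackOne A ψ x) y =
      polarizationPairingOne A.X h (A.dim - 1) x (pullbackOne A ψ' y))
    (hne : ψ' ≠ ψ)
    (hD : ∀ g : A ⟶ A, ∃ N : ℤ, N ≠ 0 ∧ End.of (N • g) ∈ Subring.closure {End.of ψ}) :
    weilClassesField A φ P (2 * m) ⊓ divisorClassesSpan A.X A.dim m = ⊥ ↔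
      ∃ ρ σ : ℂ, Polynomial.eval₂ (Int.castRingHom ℂ) ρ P = 0 ∧
        Module.finrank ℂ ↥((pullbackOne A φ).eigenspace ρ ⊓ (pullbackOne A ψ).eigenspace σ) ≠
          Module.finrank ℂ ↥((pullbackOne A φ).eigenspace ρ ⊓ (pullbackOne A ψ').eigenspace σ) :=
  weilClassesField_inf_divisorClassesSpan_eq_bot_iff_exists_finrank_ne_of_central hPm hPe hPirr hφ her hm hh hnd
    (pullbackOne_mem_centralizerAlgebra_of_forall_exists_zsmul_mem_closure_singleton hD ψ) hRm hRirr hψR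
    (pullbackOne_mem_adjoin_singleton_of_forall_exists_zsmul_mem_closure_singleton hD ψ') hadj
    (eigenspace_inf_eigenspace_eq_bot_of_ne_of_forall_exists_zsmul_mem_closure_singleton hRm hRirr hψR hD hne)
    (pullbackOne_mem_adjoin_singleton_of_forall_exists_zsmul_mem_closure_singleton hD φ)

/-- **THE DICHOTOMY for `m = 1` from `End(A)`**: `W_F ⊗ ℂ ≤ 𝒟ᵐ ⊗ ℂ` or `W_F ⊗ ℂ ⊓ 𝒟ᵐ ⊗ ℂ = ⊥`.
[cite: MoonenZarhin1998WeilClasses, §1 Criterion (2) («either all classes in W_F are decomposable, or all non-zero classes in W_F are exceptional»; chunk p0003 L59–L69)]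
[cite: Milne1999LefschetzClasses, Thm. 3.2, Cor. 4.5] -/
theorem weilClassesField_le_or_inf_divisorClassesSpan_eq_bot_of_CMField_End (hPm : P.Monic)
    (hPe : P.natDegree = e) (hPirr : Irreducible (P.map (Int.castRingHom ℚ)))
    (hφ : Polynomial.eval₂ (Int.castRingHom (CategoryTheory.End A)) (φ : CategoryTheory.End A) P = 0)
    (her : e * (2 * m) = 2 * A.dim) (hm : m ≠ 0) (hh : h ∈ hodgeClassSpan A.dim A.X 1)
    (hnd : ∀ x : complexBetti A.X 1, (∀ y, polarizationPairingOne A.X h (A.dim - 1) x y = 0) → x = 0)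
    (hRm : R.Monic) (hRirr : Irreducible (R.map (Int.castRingHom ℚ)))
    (hψR : Polynomial.eval₂ (Int.castRingHom (CategoryTheory.End A)) (ψ : CategoryTheory.End A) R = 0)
    (hadj : ∀ x y : complexBetti A.X 1, polarizationPairingOne A.X h (A.dim - 1) (pullbackOne A ψ x) y =
      polarizationPairingOne A.X h (A.dim - 1) x (pullbackOne A ψ' y))
    (hne : ψ' ≠ ψ)
    (hD : ∀ g : A ⟶ A, ∃ N : ℤ, N ≠ 0 ∧ End.of (N • g) ∈ Subring.closure {End.of ψ}) :
    weilClassesField A φ P (2 * m) ≤ divisorClassesSpan A.X A.dim m ∨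
      weilClassesField A φ P (2 * m) ⊓ divisorClassesSpan A.X A.dim m = ⊥ :=
  weilClassesField_le_or_inf_divisorClassesSpan_eq_bot_of_central hPm hPe hPirr hφ her hm hh hnd
    (pullbackOne_mem_centralizerAlgebra_of_forall_exists_zsmul_mem_closure_singleton hD ψ) hRm hRirr hψR
    (pullbackOne_mem_adjoin_singleton_of_forall_exists_zsmul_mem_closure_singleton hD ψ') hadj
    (eigenspace_inf_eigenspace_eq_bot_of_ne_of_forall_exists_zsmul_mem_closure_singleton hRm hRirr hψR hD hne)
    (pullbackOne_mem_adjoin_singleton_of_forall_exists_zsmul_mem_closure_singleton hD φ)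

end Simple

/-! ### §3 Powers `X = A^{n+1}`: `F ⊆ End⁰(X) = M_{n+1}(E)` — the dichotomy from `End(A)`-level data -/

section Powers

variable {A : AbelianVariety ℂ} {h : complexBetti A.X 2} {n : ℕ} {ψ ψ' : A ⟶ A}
  {φ : ⨁ (fun _ : Fin (n + 1) => A) ⟶ ⨁ (fun _ : Fin (n + 1) => A)} {P R : Polynomial ℤ} {e m : ℕ}

/-- **THE DECOMPOSABLE HALF ON POWERS WITH `φ^* ∈ ℂ⟨(⊕ψ)^*, (πₐ ≫ ι_b)^*⟩`** — the generation-22 theorem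
`weilClassesField_biproduct_le_divisorClassesSpan_of_entry_eq_eval₂_of_forall_finrank_eq` with its End-level hypothesis
«every entry of `φ` is an integer polynomial in `ψ`» relaxed to the carrier membership (which is what the mechanism
`weilClassesField_le_divisorClassesSpan_of_matrixUnits_of_forall_finrank_eq` consumes): balance ⟹ `W_F(X) ⊗ ℂ ≤ 𝒟ᵐ ⊗ ℂ`.
[cite: MoonenZarhin1998WeilClasses, §1 Criterion (2), case «Type 4 with d ≥ 2 or m ≥ 2» and its proof (chunk p0003 L59–L106)]
[cite: Milne1999LefschetzClasses, §1 pp. 642–644, Thm. 3.2, Cor. 4.5] [cite: McconnellRobson2001, 3.5.5–3.5.7] -/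
theorem weilClassesField_biproduct_le_divisorClassesSpan_of_mem_adjoin_diagonal_of_forall_finrank_eq (hA : 0 < A.dim)
    (hh : h ∈ hodgeClassSpan A.dim A.X 1) (htop : lefschetzPow h (A.dim - 1) 2 h ≠ 0)
    (hnd : ∀ x : complexBetti A.X 1, (∀ y, polarizationPairingOne A.X h (A.dim - 1) x y = 0) → x = 0)
    (hRm : R.Monic) (hRirr : Irreducible (R.map (Int.castRingHom ℚ)))
    (hψR : Polynomial.eval₂ (Int.castRingHom (CategoryTheory.End A)) (ψ : CategoryTheory.End A) R = 0)
    (hψ' : pullbackOne A ψ' ∈ Algebra.adjoin ℂ ({pullbackOne A ψ} : Set (Module.End ℂ (complexBetti A.X 1))))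
    (hadj : ∀ x y : complexBetti A.X 1, polarizationPairingOne A.X h (A.dim - 1) (pullbackOne A ψ x) y =
      polarizationPairingOne A.X h (A.dim - 1) x (pullbackOne A ψ' y))
    (hCM : ∀ σ : ℂ, (pullbackOne A ψ).eigenspace σ ⊓ (pullbackOne A ψ').eigenspace σ = ⊥)
    (hPm : P.Monic) (hPe : P.natDegree = e) (hPirr : Irreducible (P.map (Int.castRingHom ℚ)))
    (hφ : Polynomial.eval₂ (Int.castRingHom (CategoryTheory.End (⨁ (fun _ : Fin (n + 1) => A))))
      (φ : CategoryTheory.End (⨁ (fun _ : Fin (n + 1) => A))) P = 0)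
    (her : e * (2 * m) = 2 * ((n + 1) * A.dim))
    (hF : pullbackOne (⨁ (fun _ : Fin (n + 1) => A)) φ ∈ Algebra.adjoin ℂ
      (insert (pullbackOne (⨁ (fun _ : Fin (n + 1) => A)) (biproduct.map fun _ : Fin (n + 1) => ψ))
        (Set.range fun ab : Fin (n + 1) × Fin (n + 1) ↦ pullbackOne (⨁ (fun _ : Fin (n + 1) => A))
          (biproduct.π (fun _ : Fin (n + 1) => A) ab.1 ≫ biproduct.ι (fun _ : Fin (n + 1) => A) ab.2))))
    (hbal : ∀ ρ : ℂ, Polynomial.eval₂ (Int.castRingHom ℂ) ρ P = 0 → ∀ σ : ℂ,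
      Module.finrank ℂ ↥((pullbackOne (⨁ (fun _ : Fin (n + 1) => A)) φ).eigenspace ρ ⊓
        (pullbackOne (⨁ (fun _ : Fin (n + 1) => A)) (biproduct.map fun _ : Fin (n + 1) => ψ)).eigenspace σ) =
      Module.finrank ℂ ↥((pullbackOne (⨁ (fun _ : Fin (n + 1) => A)) φ).eigenspace ρ ⊓
        (pullbackOne (⨁ (fun _ : Fin (n + 1) => A)) (biproduct.map fun _ : Fin (n + 1) => ψ')).eigenspace σ)) :
    weilClassesField (⨁ (fun _ : Fin (n + 1) => A)) φ P (2 * m) ≤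
      divisorClassesSpan (⨁ (fun _ : Fin (n + 1) => A)).X (⨁ (fun _ : Fin (n + 1) => A)).dim m := by
  obtain ⟨hhX, -, hndX⟩ := sumPolarizationClass_hypotheses (fun _ : Fin (n + 1) => A) (fun _ => h)
      (fun _ => hA) (fun _ => hh) (fun _ => htop) (fun _ => hnd)
  have herX : e * (2 * m) = 2 * (⨁ (fun _ : Fin (n + 1) => A)).dim := by rw [dim_biproduct_const_succ A n, her]
  exact CentralTorus.weilClassesField_le_divisorClassesSpan_of_matrixUnits_of_forall_finrank_eq
    (U := fun a b ↦ pullbackOne (⨁ (fun _ : Fin (n + 1) => A))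
      (biproduct.π (fun _ : Fin (n + 1) => A) a ≫ biproduct.ι (fun _ : Fin (n + 1) => A) b))
    hPm hPe hPirr hφ herX hhX hndX (Algebra.subset_adjoin ⟨_, rfl⟩) hRm hRirr
    (aeval_pullbackOne_biproductMap_const_eq_zero hψR) (pullbackOne_biproductMap_const_mem_adjoin_of_mem_adjoin hψ')
    (fun x y ↦ polarizationPairingOne_biproductMap_of_adjoint (fun _ : Fin (n + 1) => A) (fun _ => h) (fun _ => hA)
      (fun _ => ψ) (fun _ => ψ') (fun _ => hadj) x y)
    (eigenspace_biproductMap_inf_eq_bot hCM) (0 : Fin (n + 1)) (fun a b ↦ Algebra.subset_adjoin ⟨_, rfl⟩)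
    (fun a b c d ↦ pullbackOne_π_comp_ι_mul a b c d) sum_pullbackOne_π_comp_ι
    (fun a b v w ↦ polarizationPairingOne_pullbackOne_π_comp_ι hA hh htop hnd a b v w)
    (fun a b ↦ pullbackOne_biproductMap_const_mul_π_comp_ι ψ a b) hF hbal

/-- **TYPE 4 WITH `d = 1` ON POWERS, FROM `End(A)` — «`θ = 0` ⟺ `W_F` DECOMPOSABLE».**  Let `A` be a complex abelian
variety of positive dimension, `h ∈ B¹(A) ⊗ ℂ` with `h^{dim A} ≠ 0` and `Q_h` non-degenerate, `ψ ∈ End(A)` with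
`R(ψ) = 0` (`R` monic irreducible over `ℚ`) and «`End⁰(A) = ℚ(ψ)`», and `ψ' ∈ End(A)` its Rosati image with `ψ' ≠ ψ`.
Then for `X = A^{n+1}` with the product polarization and every `φ ∈ End(X)` with `P(φ) = 0` (`P` monic irreducible of
degree `e`, `e · 2m = 2(n+1) dim A`): `W_F ⊗ ℂ ≤ 𝒟ᵐ ⊗ ℂ` IFF for every complex root `ρ` of `P` and every `σ` the
multiplicities of `σ` for `(⊕ψ)^*` and `(⊕ψ')^*` on `V_ρ` agree.  «⟸» is the hypothesis-relaxed generation-22 half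
above with `φ^* ∈ ℂ⟨(⊕ψ)^*, (πₐ ≫ ι_b)^*⟩` from §1; «⟹»: an imbalance makes `W_F` exceptional
(`weilClassesField_biproduct_inf_divisorClassesSpan_eq_bot_of_central_of_finrank_ne`, `ψ` central by §1) while `W_F ≠ 0`.
[cite: MoonenZarhin1998WeilClasses, §1 Criterion (2), case «Y is of Type 4 with d ≥ 2 or m ≥ 2 and θ non-zero» and its proof (chunk p0003 L59–L106)]
[cite: Milne1999LefschetzClasses, §1 pp. 642–644, Thm. 3.2, Cor. 4.5] [cite: McconnellRobson2001, 3.5.5–3.5.7] -/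
theorem weilClassesField_biproduct_le_divisorClassesSpan_iff_forall_finrank_eq_of_CMField_End (hA : 0 < A.dim)
    (hh : h ∈ hodgeClassSpan A.dim A.X 1) (htop : lefschetzPow h (A.dim - 1) 2 h ≠ 0)
    (hnd : ∀ x : complexBetti A.X 1, (∀ y, polarizationPairingOne A.X h (A.dim - 1) x y = 0) → x = 0)
    (hRm : R.Monic) (hRirr : Irreducible (R.map (Int.castRingHom ℚ)))
    (hψR : Polynomial.eval₂ (Int.castRingHom (CategoryTheory.End A)) (ψ : CategoryTheory.End A) R = 0)
    (hadj : ∀ x y : complexBetti A.X 1, polarizationPairingOne A.X h (A.dim - 1) (pullbackOne A ψ x) y =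
      polarizationPairingOne A.X h (A.dim - 1) x (pullbackOne A ψ' y))
    (hne : ψ' ≠ ψ)
    (hD : ∀ g : A ⟶ A, ∃ N : ℤ, N ≠ 0 ∧ End.of (N • g) ∈ Subring.closure {End.of ψ})
    (hPm : P.Monic) (hPe : P.natDegree = e) (hPirr : Irreducible (P.map (Int.castRingHom ℚ)))
    (hφ : Polynomial.eval₂ (Int.castRingHom (CategoryTheory.End (⨁ (fun _ : Fin (n + 1) => A))))
      (φ : CategoryTheory.End (⨁ (fun _ : Fin (n + 1) => A))) P = 0)
    (her : e * (2 * m) = 2 * ((n + 1) * A.dim)) :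
    weilClassesField (⨁ (fun _ : Fin (n + 1) => A)) φ P (2 * m) ≤
        divisorClassesSpan (⨁ (fun _ : Fin (n + 1) => A)).X (⨁ (fun _ : Fin (n + 1) => A)).dim m ↔
      ∀ ρ : ℂ, Polynomial.eval₂ (Int.castRingHom ℂ) ρ P = 0 → ∀ σ : ℂ,
        Module.finrank ℂ ↥((pullbackOne (⨁ (fun _ : Fin (n + 1) => A)) φ).eigenspace ρ ⊓
          (pullbackOne (⨁ (fun _ : Fin (n + 1) => A)) (biproduct.map fun _ : Fin (n + 1) => ψ)).eigenspace σ) =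
        Module.finrank ℂ ↥((pullbackOne (⨁ (fun _ : Fin (n + 1) => A)) φ).eigenspace ρ ⊓
          (pullbackOne (⨁ (fun _ : Fin (n + 1) => A)) (biproduct.map fun _ : Fin (n + 1) => ψ')).eigenspace σ) := by
  have hm : m ≠ 0 := by
    rintro rfl
    rw [mul_zero, mul_zero] at her
    have : 0 < (n + 1) * A.dim := Nat.mul_pos (Nat.succ_pos n) hA
    omega
  have hψc : ∀ χ : A ⟶ A, ψ ≫ χ = χ ≫ ψ := fun χ ↦ comp_comm_of_forall_exists_zsmul_mem_closure_singleton hD ψ χ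
  have hψ' := pullbackOne_mem_adjoin_singleton_of_forall_exists_zsmul_mem_closure_singleton hD ψ'
  have hCM := eigenspace_inf_eigenspace_eq_bot_of_ne_of_forall_exists_zsmul_mem_closure_singleton hRm hRirr hψR hD hne
  refine ⟨fun hle ρ hρ σ ↦ ?_, fun hbal ↦
    weilClassesField_biproduct_le_divisorClassesSpan_of_mem_adjoin_diagonal_of_forall_finrank_eq hA hh htop hnd hRm hRirr
      hψR hψ' hadj hCM hPm hPe hPirr hφ her
      (pullbackOne_biproduct_mem_adjoin_diagonal_of_forall_exists_zsmul_mem_closure_singleton hD φ) hbal⟩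
  by_contra hneq
  have hbot := weilClassesField_biproduct_inf_divisorClassesSpan_eq_bot_of_central_of_finrank_ne hA hh htop hnd hψc
    hRirr hψR hψ' hadj hPm hPe hPirr hφ her hm hρ hneq
  rw [inf_eq_left.2 hle] at hbot
  have herX : e * (2 * m) = 2 * (⨁ (fun _ : Fin (n + 1) => A)).dim := by rw [dim_biproduct_const_succ A n, her]
  exact weilClassesField_ne_bot hPe hPirr hφ herX (Nat.mul_ne_zero two_ne_zero hm) hbot

/-- **TYPE 4 WITH `d = 1` ON POWERS, FROM `End(A)` — «`θ ≠ 0` ⟺ ALL NON-ZERO CLASSES IN `W_F` ARE EXCEPTIONAL»**: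
under the same hypotheses, `W_F ⊗ ℂ ⊓ 𝒟ᵐ ⊗ ℂ = ⊥` IFF at some complex root `ρ` of `P` and some `σ` the multiplicities
of `σ` for `(⊕ψ)^*` and `(⊕ψ')^*` on `V_ρ` differ.
[cite: MoonenZarhin1998WeilClasses, §1 Criterion (2), case «Y is of Type 4 with d ≥ 2 or m ≥ 2 and θ non-zero» and its proof (chunk p0003 L59–L106); Remark (2) (chunk p0004 L48–L53)]
[cite: Milne1999LefschetzClasses, §1 pp. 642–644, Thm. 3.2, Cor. 4.5] -/
theorem weilClassesField_biproduct_inf_divisorClassesSpan_eq_bot_iff_exists_finrank_ne_of_CMField_End (hA : 0 < A.dim)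
    (hh : h ∈ hodgeClassSpan A.dim A.X 1) (htop : lefschetzPow h (A.dim - 1) 2 h ≠ 0)
    (hnd : ∀ x : complexBetti A.X 1, (∀ y, polarizationPairingOne A.X h (A.dim - 1) x y = 0) → x = 0)
    (hRm : R.Monic) (hRirr : Irreducible (R.map (Int.castRingHom ℚ)))
    (hψR : Polynomial.eval₂ (Int.castRingHom (CategoryTheory.End A)) (ψ : CategoryTheory.End A) R = 0)
    (hadj : ∀ x y : complexBetti A.X 1, polarizationPairingOne A.X h (A.dim - 1) (pullbackOne A ψ x) y =
      polarizationPairingOne A.X h (A.dim - 1) x (pullbackOne A ψ' y))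
    (hne : ψ' ≠ ψ)
    (hD : ∀ g : A ⟶ A, ∃ N : ℤ, N ≠ 0 ∧ End.of (N • g) ∈ Subring.closure {End.of ψ})
    (hPm : P.Monic) (hPe : P.natDegree = e) (hPirr : Irreducible (P.map (Int.castRingHom ℚ)))
    (hφ : Polynomial.eval₂ (Int.castRingHom (CategoryTheory.End (⨁ (fun _ : Fin (n + 1) => A))))
      (φ : CategoryTheory.End (⨁ (fun _ : Fin (n + 1) => A))) P = 0)
    (her : e * (2 * m) = 2 * ((n + 1) * A.dim)) :
    weilClassesField (⨁ (fun _ : Fin (n + 1) => A)) φ P (2 * m) ⊓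
        divisorClassesSpan (⨁ (fun _ : Fin (n + 1) => A)).X (⨁ (fun _ : Fin (n + 1) => A)).dim m = ⊥ ↔
      ∃ ρ σ : ℂ, Polynomial.eval₂ (Int.castRingHom ℂ) ρ P = 0 ∧
        Module.finrank ℂ ↥((pullbackOne (⨁ (fun _ : Fin (n + 1) => A)) φ).eigenspace ρ ⊓
          (pullbackOne (⨁ (fun _ : Fin (n + 1) => A)) (biproduct.map fun _ : Fin (n + 1) => ψ)).eigenspace σ) ≠
        Module.finrank ℂ ↥((pullbackOne (⨁ (fun _ : Fin (n + 1) => A)) φ).eigenspace ρ ⊓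
          (pullbackOne (⨁ (fun _ : Fin (n + 1) => A)) (biproduct.map fun _ : Fin (n + 1) => ψ')).eigenspace σ) := by
  have hm : m ≠ 0 := by
    rintro rfl
    rw [mul_zero, mul_zero] at her
    have : 0 < (n + 1) * A.dim := Nat.mul_pos (Nat.succ_pos n) hA
    omega
  have hψc : ∀ χ : A ⟶ A, ψ ≫ χ = χ ≫ ψ := fun χ ↦ comp_comm_of_forall_exists_zsmul_mem_closure_singleton hD ψ χ
  have hψ' := pullbackOne_mem_adjoin_singleton_of_forall_exists_zsmul_mem_closure_singleton hD ψ'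
  refine ⟨fun hbot ↦ ?_, fun ⟨ρ, σ, hρ, hneq⟩ ↦
    weilClassesField_biproduct_inf_divisorClassesSpan_eq_bot_of_central_of_finrank_ne hA hh htop hnd hψc hRirr hψR hψ'
      hadj hPm hPe hPirr hφ her hm hρ hneq⟩
  by_contra hall
  push Not at hall
  have hle := (weilClassesField_biproduct_le_divisorClassesSpan_iff_forall_finrank_eq_of_CMField_End hA hh htop hnd hRm
    hRirr hψR hadj hne hD hPm hPe hPirr hφ her).2 fun ρ hρ σ ↦ hall ρ σ hρ
  rw [inf_eq_left.2 hle] at hbot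
  have herX : e * (2 * m) = 2 * (⨁ (fun _ : Fin (n + 1) => A)).dim := by rw [dim_biproduct_const_succ A n, her]
  exact weilClassesField_ne_bot hPe hPirr hφ herX (Nat.mul_ne_zero two_ne_zero hm) hbot

/-- **THE DICHOTOMY ON POWERS from `End(A)`**: `W_F ⊗ ℂ ≤ 𝒟ᵐ ⊗ ℂ` or `W_F ⊗ ℂ ⊓ 𝒟ᵐ ⊗ ℂ = ⊥`.
[cite: MoonenZarhin1998WeilClasses, §1 Criterion (2) («either all classes in W_F are decomposable, or all non-zero classes in W_F are exceptional»; chunk p0003 L59–L69)]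
[cite: Milne1999LefschetzClasses, Thm. 3.2, Cor. 4.5] -/
theorem weilClassesField_biproduct_le_or_inf_divisorClassesSpan_eq_bot_of_CMField_End (hA : 0 < A.dim)
    (hh : h ∈ hodgeClassSpan A.dim A.X 1) (htop : lefschetzPow h (A.dim - 1) 2 h ≠ 0)
    (hnd : ∀ x : complexBetti A.X 1, (∀ y, polarizationPairingOne A.X h (A.dim - 1) x y = 0) → x = 0)
    (hRm : R.Monic) (hRirr : Irreducible (R.map (Int.castRingHom ℚ)))
    (hψR : Polynomial.eval₂ (Int.castRingHom (CategoryTheory.End A)) (ψ : CategoryTheory.End A) R = 0)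
    (hadj : ∀ x y : complexBetti A.X 1, polarizationPairingOne A.X h (A.dim - 1) (pullbackOne A ψ x) y =
      polarizationPairingOne A.X h (A.dim - 1) x (pullbackOne A ψ' y))
    (hne : ψ' ≠ ψ)
    (hD : ∀ g : A ⟶ A, ∃ N : ℤ, N ≠ 0 ∧ End.of (N • g) ∈ Subring.closure {End.of ψ})
    (hPm : P.Monic) (hPe : P.natDegree = e) (hPirr : Irreducible (P.map (Int.castRingHom ℚ)))
    (hφ : Polynomial.eval₂ (Int.castRingHom (CategoryTheory.End (⨁ (fun _ : Fin (n + 1) => A))))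
      (φ : CategoryTheory.End (⨁ (fun _ : Fin (n + 1) => A))) P = 0)
    (her : e * (2 * m) = 2 * ((n + 1) * A.dim)) :
    weilClassesField (⨁ (fun _ : Fin (n + 1) => A)) φ P (2 * m) ≤
        divisorClassesSpan (⨁ (fun _ : Fin (n + 1) => A)).X (⨁ (fun _ : Fin (n + 1) => A)).dim m ∨
      weilClassesField (⨁ (fun _ : Fin (n + 1) => A)) φ P (2 * m) ⊓
        divisorClassesSpan (⨁ (fun _ : Fin (n + 1) => A)).X (⨁ (fun _ : Fin (n + 1) => A)).dim m = ⊥ := by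
  by_cases hbal : ∀ ρ : ℂ, Polynomial.eval₂ (Int.castRingHom ℂ) ρ P = 0 → ∀ σ : ℂ,
      Module.finrank ℂ ↥((pullbackOne (⨁ (fun _ : Fin (n + 1) => A)) φ).eigenspace ρ ⊓
        (pullbackOne (⨁ (fun _ : Fin (n + 1) => A)) (biproduct.map fun _ : Fin (n + 1) => ψ)).eigenspace σ) =
      Module.finrank ℂ ↥((pullbackOne (⨁ (fun _ : Fin (n + 1) => A)) φ).eigenspace ρ ⊓
        (pullbackOne (⨁ (fun _ : Fin (n + 1) => A)) (biproduct.map fun _ : Fin (n + 1) => ψ')).eigenspace σ)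
  · exact Or.inl ((weilClassesField_biproduct_le_divisorClassesSpan_iff_forall_finrank_eq_of_CMField_End hA hh htop hnd
      hRm hRirr hψR hadj hne hD hPm hPe hPirr hφ her).2 hbal)
  · push Not at hbal
    obtain ⟨ρ, hρ, σ, hneq⟩ := hbal
    exact Or.inr ((weilClassesField_biproduct_inf_divisorClassesSpan_eq_bot_iff_exists_finrank_ne_of_CMField_End hA hh
      htop hnd hRm hRirr hψR hadj hne hD hPm hPe hPirr hφ her).2 ⟨ρ, σ, hρ, hneq⟩)

end Powers

end Literature.AlgebraicGeometry.HodgeTheory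

end
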